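import Summits.Ventures.PercRepro.Night2LocalRuleMissed

/-!
# PercRepro — the GOOD-TARGET shares of the hybrid rule (night-2, gen 29)

A fourth concrete share function for `localShadowHall_of_hybrid`.  The loss of a `P`-pair `(B, z)` at its covering set
`Q = B ∪ {z}` is split equally over the **good targets** `Q ∪ {x}`, `x` ranging over the points of `G ∖ Q` that lie in
the closure of AT MOST ONE thin face of `Q` (a `good point`); when `Q` has no good point the loss falls back to the
missed-point targets of `Night2LocalRuleMissed`.  In the cell `(2, 1)` with at most one fat closure a lossy big covering
set `Q` has three thin faces with closures `H₁, H₂, H₃` through a common line (`Night2OneFatFaces`); a good point is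
a point outside at least two of them, so a good target has at most one coloop off `K` and keeps `cap2 ≥ 23/72`,
while the missed-point targets inside two of the closures keep only `cap2 ≥ 31/360` — the rule of record of gen 25
fails there (proofs/NIGHT-2-g29.md §1: column ratio `1.052` on an explicit `GF(13)` instance where (LI_G) holds with
margin `≥ 1.5`).

* `thinFacesOf`, `gtPts`, `gtTargets`, `dshGT`;
* `mem_goodTargets`, `goodTargets_subset_shadowAt`, `card_goodTargets` (`= #gtPts`), `goodTargets_nonempty_iff`;
* `dshGood_nonneg`, `dshGood_supp`, `dshGood_row` (the shares of a thin pair sum to its loss);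
* **`localShadowHall_of_gt`**: `localShadowHall_of_hybrid` with `dsh := dshGT`.
-/

namespace PercRepro.Shadow

open Finset PerFlat ThmH

variable {α : Type*} [DecidableEq α] {M : Matroid α} [M.Finite]

section Good

variable (M) (q : ℕ) (G : Finset α)

open scoped Classical in
/-- The thin faces of a set `Q`: its thin covering preimages. -/
noncomputable def thinFacesOf (Q : Finset α) : Finset (Finset α) :=
  (coverPreimages M (Uq M (q + 2) q) G Q).filter (fun F => F ∉ lay0 M q G)

open scoped Classical in
/-- The good points of `Q`: the points of `G ∖ Q` lying in the closure of at most one thin face of `Q`. -/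
noncomputable def gtPts (Q : Finset α) : Finset α :=
  (G \ Q).filter (fun x => ((thinFacesOf M q G Q).filter (fun F => x ∈ clF M F)).card ≤ 1)

/-- The good targets of the pair `(B, z)`: the sets `B ∪ {z, x}` for the good points `x` of `B ∪ {z}`. -/
noncomputable def gtTargets (B : Finset α) (z : α) : Finset (Finset α) :=
  (gtPts M q G (insert z B)).image (fun x => insert x (insert z B))

/-- The good-target shares: the loss of `(B, z)` split equally over its good targets, or over its missed-point
targets when `B ∪ {z}` has no good point. -/
noncomputable def dshGT (B : Finset α) (z : α) (S : Finset α) : ℚ :=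
  if (gtPts M q G (insert z B)).Nonempty then
    (if S ∈ gtTargets M q G B z then loss M q G B z / ((gtTargets M q G B z).card : ℚ) else 0)
  else dshMissed M q G B z S

end Good

section GoodLemmas

variable {q : ℕ} {G : Finset α}

open scoped Classical in
/-- Membership in `gtPts`. -/
theorem mem_goodPts {Q : Finset α} {x : α} :
    x ∈ gtPts M q G Q ↔ x ∈ G \ Q ∧ ((thinFacesOf M q G Q).filter (fun F => x ∈ clF M F)).card ≤ 1 := by
  unfold gtPts
  rw [Finset.mem_filter]

/-- Membership in `gtTargets`. -/
theorem mem_goodTargets {B S : Finset α} {z : α} :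
    S ∈ gtTargets M q G B z ↔ ∃ x ∈ gtPts M q G (insert z B), insert x (insert z B) = S := by
  unfold gtTargets
  rw [Finset.mem_image]

/-- A good point of `Q` is not in `Q`. -/
theorem notMem_of_mem_goodPts {Q : Finset α} {x : α} (hx : x ∈ gtPts M q G Q) : x ∉ Q :=
  (Finset.mem_sdiff.1 (mem_goodPts.1 hx).1).2

/-- The good targets of a pair of a member inside `G` are shadow sets. -/
theorem goodTargets_subset_shadowAt (hG : G ∈ flatsQ M (q + 1)) {B : Finset α}
    (hB : B ∈ membersIn M (Uq M (q + 2) q) G) {z : α} (hz : z ∈ G \ clF M B) :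
    gtTargets M q G B z ⊆ shadowAt M (q + 2) q (Uq M (q + 2) q) G := by
  intro S hS
  obtain ⟨x, hx, rfl⟩ := mem_goodTargets.1 hS
  have hBG : clF M B ⊆ G := (mem_membersIn.1 hB).2
  have hBU : B ∈ Uq M (q + 2) q := (mem_membersIn.1 hB).1
  have hBsub : B ⊆ G := (subset_clF hBU).trans hBG
  exact superset_mem_shadowAt hG hB hz (Finset.subset_insert x _)
    (Finset.insert_subset (Finset.mem_sdiff.1 (mem_goodPts.1 hx).1).1
      (Finset.insert_subset (Finset.mem_sdiff.1 hz).1 hBsub))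

/-- `#gtTargets B z = #gtPts (B ∪ {z})`. -/
theorem card_goodTargets (B : Finset α) (z : α) :
    (gtTargets M q G B z).card = (gtPts M q G (insert z B)).card := by
  unfold gtTargets
  rw [Finset.card_image_of_injOn]
  intro x hx y hy hxy
  rw [Finset.mem_coe] at hx hy
  dsimp only at hxy
  have hxB : x ∉ insert z B := notMem_of_mem_goodPts hx
  have h1 : x ∈ insert y (insert z B) := by
    rw [← hxy]; exact Finset.mem_insert_self x _
  rw [Finset.mem_insert] at h1
  rcases h1 with h1 | h1
  · exact h1
  · exact absurd h1 hxB

/-- The good-target shares are nonnegative. -/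
theorem dshGood_nonneg (hG : G ∈ flatsQ M (q + 1)) (hd : (gr M \ G).card ≤ q) (B : Finset α) (z : α)
    (S : Finset α) : 0 ≤ dshGT M q G B z S := by
  unfold dshGT
  split_ifs
  · exact div_nonneg (loss_nonneg' hG hd B z) (by positivity)
  · exact le_refl _
  · exact dshMissed_nonneg hG hd B z S

/-- The good-target shares are supported on the supersets of `B ∪ {z}`. -/
theorem dshGood_supp (B : Finset α) (z : α) (S : Finset α) (h : dshGT M q G B z S ≠ 0) :
    insert z B ⊆ S := by
  unfold dshGT at h
  split_ifs at h with hne hS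
  · obtain ⟨x, -, rfl⟩ := mem_goodTargets.1 hS
    exact Finset.subset_insert x _
  · exact absurd rfl h
  · exact dshMissed_supp B z S h

open scoped Classical in
/-- The good-target shares of a thin pair sum to its loss. -/
theorem dshGood_row (hG : G ∈ flatsQ M (q + 1)) (hd : (gr M \ G).card ≤ q) {B : Finset α}
    (hB : B ∈ thinMembers M q G) {z : α} (hz : z ∈ G \ clF M B) :
    ∑ S ∈ shadowAt M (q + 2) q (Uq M (q + 2) q) G, dshGT M q G B z S = loss M q G B z := by
  unfold dshGT
  by_cases hne : (gtPts M q G (insert z B)).Nonempty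
  · simp only [if_pos hne]
    rw [← Finset.sum_filter, Finset.filter_mem_eq_inter,
      Finset.inter_eq_right.2 (goodTargets_subset_shadowAt hG (mem_thinMembers.1 hB).1 hz),
      Finset.sum_const, nsmul_eq_mul]
    have hpos : (0 : ℚ) < ((gtTargets M q G B z).card : ℚ) := by
      rw [card_goodTargets]
      exact_mod_cast Finset.card_pos.2 hne
    field_simp
  · simp only [if_neg hne]
    exact dshMissed_row hG hd hB hz

/-- The share received by a good target is `loss/#gtPts`. -/
theorem dshGood_of_mem {B : Finset α} {z : α} {S : Finset α} (hS : S ∈ gtTargets M q G B z) :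
    dshGT M q G B z S = loss M q G B z / ((gtPts M q G (insert z B)).card : ℚ) := by
  have hne : (gtPts M q G (insert z B)).Nonempty := by
    obtain ⟨x, hx, -⟩ := mem_goodTargets.1 hS
    exact ⟨x, hx⟩
  unfold dshGT
  rw [if_pos hne, if_pos hS, card_goodTargets]

/-- With a good point, the shares vanish off the good targets. -/
theorem dshGood_eq_zero_of_notMem {B : Finset α} {z : α} (hne : (gtPts M q G (insert z B)).Nonempty)
    {S : Finset α} (hS : S ∉ gtTargets M q G B z) : dshGT M q G B z S = 0 := by
  unfold dshGT
  rw [if_pos hne, if_neg hS]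

/-- Without a good point, the shares are the missed-point shares. -/
theorem dshGood_eq_dshMissed_of_empty {B : Finset α} {z : α} (hne : ¬ (gtPts M q G (insert z B)).Nonempty)
    (S : Finset α) : dshGT M q G B z S = dshMissed M q G B z S := by
  unfold dshGT
  rw [if_neg hne]

open scoped Classical in
/-- **The local form from the hybrid rule with the good-target shares**: (LI_G) follows from (i) the column bound
`dload S ≤ cap2 S` at every shadow set and (ii) the per-loss inequality of the non-`P` pairs with the capacities
`cap3`. -/
theorem localShadowHall_of_gt {P : Finset α → Prop} [DecidablePred P] (hG : G ∈ flatsQ M (q + 1))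
    (hd : (gr M \ G).card ≤ q)
    (hdl : ∀ S ∈ shadowAt M (q + 2) q (Uq M (q + 2) q) G,
      dload M q G P (dshGT M q G) S ≤ cap2 M q G S)
    (hcond : ∀ B ∈ thinMembers M q G, ¬ P B → ∀ z ∈ G \ clF M B,
      loss M q G B z ≤ rhoL M q G B z * lossIncomeH M q G P (dshGT M q G) B z) :
    LocalShadowHall M q G :=
  localShadowHall_of_hybrid hG hd (dshGood_nonneg hG hd) (dshGood_supp)
    (fun _ hB _ _ hz => dshGood_row hG hd hB hz) hdl hcond

end GoodLemmas

end PercRepro.Shadow
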